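import Literature.NumberTheory.Rogawski1990.AdelicStableOrbitalSupportFinite
import HarnessLib

/-!
# The adelic stable class READS as a restricted product: `𝒞_𝐀(γ₀) ≅ {(δ_v)_v : δ_v ∈ 𝒞_v, δ_v = [γ_v] a.e.} × 𝒞_∞` for `G = U(Φ₃)`
(Rogawski (1990), §3.3 p. 21: «`𝒪_st(γ∕𝐀)` … `γ′_v` is conjugate to `γ` by an element of `K_v` for almost all `v`»; §4.3 p. 44: «we may therefore set
`Φ^κ(γ, f) = Π_v Φ^{κ_v}(γ, f_v)`»; §5.4 pp. 72–73; Kottwitz (1986) Prop. 7.1)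

Topic `NumberTheory/Rogawski1990`; namespace `Literature.NumberTheory.Rogawski1990` (sequel of ★ T1b-9G `AdelicStableConjugacyG` and of ★ F0P3a-p08
`AdelicStableOrbitalSupportFinite` §1, whose gluing lemmas it packages).  THEOREMS ONLY: no definition, no named fact, no instance, no `sorry`.  Cell
`pub/hodgecm-mathlib`, ENGINE T1, ED 1.19c (xii-d) ∕ O11: this file supplies the DICTIONARY hypotheses (inj)(img)(ev)(surj) of ★ (E1)
`Literature.Topology.Algebra.RestrictedProduct.finsum_mem_eq_finsum_mul_prod_finsum_of_factor` for the class set `𝒞 := MatchingAdeleG.classes L H γ₀`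
with the class maps `π_v := ConjClasses.map (toLocal v)`, `π_∞ := ConjClasses.map archPart`, the local stable class sets
`St_v := {d | (γ₀)_v ↔ out d}` (★ `Corresponds`), the archimedean one `St_∞ := {b | γ₀ ⊗ 1 ↔ out b}`, and the base classes `e_v := [γ_v]` of a rational
correspondent `γ ∈ U(Φ₃)(L⁺)`:

* (img) `MatchingAdeleG.corresponds_out_map_toLocal`, `MatchingAdeleG.corresponds_out_map_archPart` — the local ∕ archimedean classes of a class of
  `𝒞_𝐀(γ₀)` lie in the local ∕ archimedean stable classes;
* (ev) `MatchingAdeleG.eventually_map_toLocal_eq_mk` — under ★ `MatchingAdeleGEventuallyKConj` ([Kt₄] Prop. 7.1, `K_v`-form) the local class is the base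
  class `[γ_v]` at all but finitely many `v`;
* (inj) `MatchingAdeleG.eq_of_forall_map_toLocal_eq_of_map_archPart_eq` — a class of `𝒞_𝐀(γ₀)` is determined by its local classes and its
  archimedean class (★ p08 `UnitaryGroup.isConj_of_isConj_archPart_of_forall_exists_conj`, integral conjugators a.e. from the `K_v`-form fact);
* (surj) `MatchingAdeleG.exists_mem_classes_of_forall` — every family of local classes in the local stable classes which is the base class a.e.,
  with every archimedean class in the archimedean stable class, is read by some class of `𝒞_𝐀(γ₀)` (★ p08 `UnitaryGroup.exists_adelic_of_eventually_mem`
  with the representatives `γ_v` on the base classes).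
HC_CM is proved only modulo the printed citations until rung 0 closes; this file is unconditional (the [Kt₄] fact enters as a hypothesis BY NAME).

## References
* [Rogawski1990] J. D. Rogawski, *Automorphic Representations of Unitary Groups in Three Variables*, Ann. of Math. Stud. 123 (1990), §3.3 p. 21, §4.3 p. 44,
  §5.4 pp. 72–73.
* [Kottwitz1986] R. E. Kottwitz, *Stable trace formula: elliptic singular terms*, Math. Ann. 275 (1986), Prop. 7.1.
* [BorelJacquet1979] A. Borel, H. Jacquet, *Automorphic forms and automorphic representations*, PSPM 33.1 (1979), §4.1.
-/

noncomputable section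

open NumberField IsDedekindDomain Filter
open scoped MatrixGroups

namespace Literature.NumberTheory.Rogawski1990

open Literature.NumberTheory.Automorphic

section Dictionary

variable {L : Type} [Field L] [NumberField L] [IsCMField L] {H : Matrix (Fin 3) (Fin 3) L}
  {γ₀ : (UnitaryGroup.cmDatum L 3 H).Rational}

/-- `ConjClasses.map f [x] = [f x]` (definitional; plumbing for the class maps `π_v`, `π_∞`). [cite: BorelJacquet1979, §4.1] -/
theorem conjClasses_map_mk {A B : Type*} [Monoid A] [Monoid B] (f : A →* B) (x : A) :
    ConjClasses.map f (ConjClasses.mk x) = ConjClasses.mk (f x) := rfl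

/-- `[out c] = c` (plumbing). [cite: BorelJacquet1979, §4.1] -/
theorem conjClasses_mk_out_eq {A : Type*} [Monoid A] (c : ConjClasses A) : ConjClasses.mk (Quotient.out c) = c := by
  rw [← ConjClasses.quotient_mk_eq_mk, Quotient.out_eq]

/-- `x ∼ out [x]` (plumbing). [cite: BorelJacquet1979, §4.1] -/
theorem isConj_out_conjClasses_mk {A : Type*} [Monoid A] (x : A) : IsConj x (Quotient.out (ConjClasses.mk x)) :=
  ConjClasses.mk_eq_mk_iff_isConj.1 (conjClasses_mk_out_eq _).symm

/-! ## §1 (img) local and archimedean classes of `𝒞_𝐀(γ₀)` lie in the stable classes -/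

/-- **(img, finite places)**: for a class `c ∈ 𝒞_𝐀(γ₀)` and a finite place `v`, the representative of its local class `ConjClasses.map (toLocal v) c`
CORRESPONDS to `(γ₀)_v` (★ `MatchingAdeleG.corresponds_toLocal`; `↔` is constant on stable classes, ★ `Corresponds.of_isStablyConj_right`).
[cite: Rogawski1990, §3.3 p. 21] -/
theorem MatchingAdeleG.corresponds_out_map_toLocal
    {c : ConjClasses (UnitaryGroup.cmDatum L 3 (Matrix.of fun i j : Fin 3 => if i.val + j.val + 1 = 3 then (1 : L) else 0)).Adelic}
    (hc : c ∈ MatchingAdeleG.classes L H γ₀) (v : HeightOneSpectrum (𝓞 ↥(maximalRealSubfield L))) :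
    Corresponds (UnitaryGroup.conjLocal L (IsCMField.complexConj L) v)
      ((UnitaryGroup.adelicForm L 3 H).map (UnitaryGroup.adeleToLocal L v))
      ((UnitaryGroup.adelicForm L 3 (Matrix.of fun i j : Fin 3 => if i.val + j.val + 1 = 3 then (1 : L) else 0)).map (UnitaryGroup.adeleToLocal L v))
      ((UnitaryGroup.cmDatum L 3 H).toLocal v ((UnitaryGroup.cmDatum L 3 H).toAdelic γ₀))
      (Quotient.out (ConjClasses.map ((UnitaryGroup.cmDatum L 3
        (Matrix.of fun i j : Fin 3 => if i.val + j.val + 1 = 3 then (1 : L) else 0)).toLocal v) c)) := by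
  obtain ⟨p, rfl⟩ := hc
  exact (p.corresponds_toLocal v).of_isStablyConj_right (isStablyConj_of_isConj (isConj_out_conjClasses_mk _))

/-- **(img, archimedean)**: the representative of the archimedean class `ConjClasses.map archPart c` of `c ∈ 𝒞_𝐀(γ₀)` corresponds to `γ₀ ⊗ 1`
(★ `MatchingAdeleG.corresponds_arch`). [cite: Rogawski1990, §5.4 p. 72] -/
theorem MatchingAdeleG.corresponds_out_map_archPart
    {c : ConjClasses (UnitaryGroup.cmDatum L 3 (Matrix.of fun i j : Fin 3 => if i.val + j.val + 1 = 3 then (1 : L) else 0)).Adelic}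
    (hc : c ∈ MatchingAdeleG.classes L H γ₀) :
    Corresponds (UnitaryGroup.conjMixed (↥(maximalRealSubfield L)) L (IsCMField.complexConj L)) (UnitaryGroup.archFormOf L 3 H)
      (UnitaryGroup.archFormOf L 3 (Matrix.of fun i j : Fin 3 => if i.val + j.val + 1 = 3 then (1 : L) else 0))
      (cmRationalToArch L 3 H γ₀)
      (Quotient.out (ConjClasses.map (UnitaryGroup.archPart (↥(maximalRealSubfield L)) L (IsCMField.complexConj L) 3
        (Matrix.of fun i j : Fin 3 => if i.val + j.val + 1 = 3 then (1 : L) else 0)) c)) := by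
  obtain ⟨p, rfl⟩ := hc
  exact p.corresponds_arch.of_isStablyConj_right (isStablyConj_of_isConj (isConj_out_conjClasses_mk _))

/-! ## §2 (ev) the local class is the base class almost everywhere -/

/-- **(ev)**: under the named fact ★ `MatchingAdeleGEventuallyKConj` ([Kt₄] Prop. 7.1 in print's `K_v`-form), for `γ₀` regular with rational correspondent
`γ ∈ U(Φ₃)(L⁺)`, the local class of any `c ∈ 𝒞_𝐀(γ₀)` is the base class `[γ_v]` for all but finitely many `v` (the components of a matching adèle are
integral a.e., ★ `eventually_toLocal_mem_cmLocalIntegralLevel`, hence `K_v`-conjugate to `γ_v` a.e.). [cite: Rogawski1990, §3.3 p. 21]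
[cite: Kottwitz1986, Prop. 7.1] -/
theorem MatchingAdeleG.eventually_map_toLocal_eq_mk (hKC : MatchingAdeleGEventuallyKConj L H)
    (hreg : IsRegularElt (γ₀.val : GL (Fin 3) L))
    {γ : (UnitaryGroup.cmDatum L 3 (Matrix.of fun i j : Fin 3 => if i.val + j.val + 1 = 3 then (1 : L) else 0)).Rational}
    (hγ : Corresponds (cmConjRingHom L) H (Matrix.of fun i j : Fin 3 => if i.val + j.val + 1 = 3 then (1 : L) else 0) γ₀ γ)
    {c : ConjClasses (UnitaryGroup.cmDatum L 3 (Matrix.of fun i j : Fin 3 => if i.val + j.val + 1 = 3 then (1 : L) else 0)).Adelic}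
    (hc : c ∈ MatchingAdeleG.classes L H γ₀) :
    ∀ᶠ v in cofinite, ConjClasses.map ((UnitaryGroup.cmDatum L 3
        (Matrix.of fun i j : Fin 3 => if i.val + j.val + 1 = 3 then (1 : L) else 0)).toLocal v) c =
      ConjClasses.mk ((UnitaryGroup.cmDatum L 3 (Matrix.of fun i j : Fin 3 => if i.val + j.val + 1 = 3 then (1 : L) else 0)).toLocal v
        ((UnitaryGroup.cmDatum L 3 (Matrix.of fun i j : Fin 3 => if i.val + j.val + 1 = 3 then (1 : L) else 0)).toAdelic γ)) := by
  obtain ⟨p, rfl⟩ := hc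
  filter_upwards [hKC.eventually_forall_exists_conj hreg hγ, eventually_toLocal_mem_cmLocalIntegralLevel p.adele] with v hv hint
  obtain ⟨k, -, hk⟩ := hv p hint
  rw [conjClasses_map_mk, ConjClasses.mk_eq_mk_iff_isConj]
  exact (isConj_iff.2 ⟨k, hk⟩).symm

/-! ## §3 (inj) a class of `𝒞_𝐀(γ₀)` is determined by its local classes and its archimedean class -/

/-- **(inj) — the gluing**: under ★ `MatchingAdeleGEventuallyKConj`, two classes of `𝒞_𝐀(γ₀)` (`γ₀` regular with a rational correspondent `γ`) with the
same local class at every finite place and the same archimedean class are EQUAL: their representatives are conjugate at every place and, at almost every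
place, conjugate BY AN INTEGRAL ELEMENT (both being `K_v`-conjugate to `γ_v` there), so they are `G(𝐀)`-conjugate (★ p08
`UnitaryGroup.isConj_of_isConj_archPart_of_forall_exists_conj`). [cite: Rogawski1990, §3.3 p. 21] [cite: Kottwitz1986, Prop. 7.1] -/
theorem MatchingAdeleG.eq_of_forall_map_toLocal_eq_of_map_archPart_eq (hKC : MatchingAdeleGEventuallyKConj L H)
    (hreg : IsRegularElt (γ₀.val : GL (Fin 3) L))
    {γ : (UnitaryGroup.cmDatum L 3 (Matrix.of fun i j : Fin 3 => if i.val + j.val + 1 = 3 then (1 : L) else 0)).Rational}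
    (hγ : Corresponds (cmConjRingHom L) H (Matrix.of fun i j : Fin 3 => if i.val + j.val + 1 = 3 then (1 : L) else 0) γ₀ γ)
    {c c' : ConjClasses (UnitaryGroup.cmDatum L 3 (Matrix.of fun i j : Fin 3 => if i.val + j.val + 1 = 3 then (1 : L) else 0)).Adelic}
    (hc : c ∈ MatchingAdeleG.classes L H γ₀) (hc' : c' ∈ MatchingAdeleG.classes L H γ₀)
    (hv : ∀ v : HeightOneSpectrum (𝓞 ↥(maximalRealSubfield L)),
      ConjClasses.map ((UnitaryGroup.cmDatum L 3 (Matrix.of fun i j : Fin 3 => if i.val + j.val + 1 = 3 then (1 : L) else 0)).toLocal v) c =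
        ConjClasses.map ((UnitaryGroup.cmDatum L 3 (Matrix.of fun i j : Fin 3 => if i.val + j.val + 1 = 3 then (1 : L) else 0)).toLocal v) c')
    (ha : ConjClasses.map (UnitaryGroup.archPart (↥(maximalRealSubfield L)) L (IsCMField.complexConj L) 3
          (Matrix.of fun i j : Fin 3 => if i.val + j.val + 1 = 3 then (1 : L) else 0)) c =
        ConjClasses.map (UnitaryGroup.archPart (↥(maximalRealSubfield L)) L (IsCMField.complexConj L) 3
          (Matrix.of fun i j : Fin 3 => if i.val + j.val + 1 = 3 then (1 : L) else 0)) c') :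
    c = c' := by
  obtain ⟨p, rfl⟩ := hc
  obtain ⟨p', rfl⟩ := hc'
  dsimp only at hv ha ⊢
  rw [ConjClasses.mk_eq_mk_iff_isConj]
  have ha' : IsConj
      (UnitaryGroup.archPart (↥(maximalRealSubfield L)) L (IsCMField.complexConj L) 3
        (Matrix.of fun i j : Fin 3 => if i.val + j.val + 1 = 3 then (1 : L) else 0) p.adele)
      (UnitaryGroup.archPart (↥(maximalRealSubfield L)) L (IsCMField.complexConj L) 3
        (Matrix.of fun i j : Fin 3 => if i.val + j.val + 1 = 3 then (1 : L) else 0) p'.adele) :=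
    ConjClasses.mk_eq_mk_iff_isConj.1 ha
  have hv' : ∀ v : HeightOneSpectrum (𝓞 ↥(maximalRealSubfield L)),
      IsConj ((UnitaryGroup.cmDatum L 3 (Matrix.of fun i j : Fin 3 => if i.val + j.val + 1 = 3 then (1 : L) else 0)).toLocal v p.adele)
        ((UnitaryGroup.cmDatum L 3 (Matrix.of fun i j : Fin 3 => if i.val + j.val + 1 = 3 then (1 : L) else 0)).toLocal v p'.adele) :=
    fun v => ConjClasses.mk_eq_mk_iff_isConj.1 (hv v)
  have hK : ∀ᶠ v in cofinite, ∃ k : (UnitaryGroup.cmDatum L 3 (Matrix.of fun i j : Fin 3 => if i.val + j.val + 1 = 3 then (1 : L) else 0)).Local v,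
      k ∈ UnitaryGroup.cmLocalIntegralLevel L 3 (Matrix.of fun i j : Fin 3 => if i.val + j.val + 1 = 3 then (1 : L) else 0) v ∧
        k * (UnitaryGroup.cmDatum L 3 (Matrix.of fun i j : Fin 3 => if i.val + j.val + 1 = 3 then (1 : L) else 0)).toLocal v p.adele * k⁻¹ =
          (UnitaryGroup.cmDatum L 3 (Matrix.of fun i j : Fin 3 => if i.val + j.val + 1 = 3 then (1 : L) else 0)).toLocal v p'.adele := by
    filter_upwards [hKC.eventually_forall_exists_conj hreg hγ, eventually_toLocal_mem_cmLocalIntegralLevel p.adele,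
      eventually_toLocal_mem_cmLocalIntegralLevel p'.adele] with v hKv hint hint'
    obtain ⟨k, hk, hkp⟩ := hKv p hint
    obtain ⟨k', hk', hkp'⟩ := hKv p' hint'
    refine ⟨k' * k⁻¹, mul_mem hk' (inv_mem hk), ?_⟩
    rw [← hkp, ← hkp']
    group
  exact UnitaryGroup.isConj_of_isConj_archPart_of_forall_exists_conj (↥(maximalRealSubfield L)) L (IsCMField.complexConj L) 3
    (Matrix.of fun i j : Fin 3 => if i.val + j.val + 1 = 3 then (1 : L) else 0) ha' hv' hK

/-! ## §4 (surj) every admissible family of local classes and archimedean class is read by a class of `𝒞_𝐀(γ₀)` -/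

/-- **(surj)**: let `γ₀ ↔ γ` (`γ ∈ U(Φ₃)(L⁺)` rational).  Every family `δ` of local classes with `(γ₀)_v ↔ out (δ v)` at every `v` and `δ v = [γ_v]` for
almost all `v`, together with every archimedean class `b` with `γ₀ ⊗ 1 ↔ out b`, is the family of local ∕ archimedean classes of some `c ∈ 𝒞_𝐀(γ₀)` —
glue the representatives (`γ_v` on the base classes, so integral a.e.: ★ `eventually_toLocal_mem_cmLocalIntegralLevel`) by ★ p08
`UnitaryGroup.exists_adelic_of_eventually_mem`; the glued adèle is matching since `↔` is constant on stable classes. [cite: Rogawski1990, §3.3 p. 21; §5.4 p. 72]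
[cite: BorelJacquet1979, §4.1] -/
theorem MatchingAdeleG.exists_mem_classes_of_forall
    {γ : (UnitaryGroup.cmDatum L 3 (Matrix.of fun i j : Fin 3 => if i.val + j.val + 1 = 3 then (1 : L) else 0)).Rational}
    (hγ : Corresponds (cmConjRingHom L) H (Matrix.of fun i j : Fin 3 => if i.val + j.val + 1 = 3 then (1 : L) else 0) γ₀ γ)
    (δ : ∀ v : HeightOneSpectrum (𝓞 ↥(maximalRealSubfield L)),
      ConjClasses ((UnitaryGroup.cmDatum L 3 (Matrix.of fun i j : Fin 3 => if i.val + j.val + 1 = 3 then (1 : L) else 0)).Local v))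
    (b : ConjClasses (UnitaryGroup.arch (↥(maximalRealSubfield L)) L (IsCMField.complexConj L) 3
      (Matrix.of fun i j : Fin 3 => if i.val + j.val + 1 = 3 then (1 : L) else 0)))
    (hδ : ∀ v, Corresponds (UnitaryGroup.conjLocal L (IsCMField.complexConj L) v)
      ((UnitaryGroup.adelicForm L 3 H).map (UnitaryGroup.adeleToLocal L v))
      ((UnitaryGroup.adelicForm L 3 (Matrix.of fun i j : Fin 3 => if i.val + j.val + 1 = 3 then (1 : L) else 0)).map (UnitaryGroup.adeleToLocal L v))
      ((UnitaryGroup.cmDatum L 3 H).toLocal v ((UnitaryGroup.cmDatum L 3 H).toAdelic γ₀)) (Quotient.out (δ v)))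
    (hev : ∀ᶠ v in cofinite, δ v = ConjClasses.mk ((UnitaryGroup.cmDatum L 3
      (Matrix.of fun i j : Fin 3 => if i.val + j.val + 1 = 3 then (1 : L) else 0)).toLocal v
        ((UnitaryGroup.cmDatum L 3 (Matrix.of fun i j : Fin 3 => if i.val + j.val + 1 = 3 then (1 : L) else 0)).toAdelic γ)))
    (hb : Corresponds (UnitaryGroup.conjMixed (↥(maximalRealSubfield L)) L (IsCMField.complexConj L)) (UnitaryGroup.archFormOf L 3 H)
      (UnitaryGroup.archFormOf L 3 (Matrix.of fun i j : Fin 3 => if i.val + j.val + 1 = 3 then (1 : L) else 0))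
      (cmRationalToArch L 3 H γ₀) (Quotient.out b)) :
    ∃ c ∈ MatchingAdeleG.classes L H γ₀,
      (∀ v, ConjClasses.map ((UnitaryGroup.cmDatum L 3 (Matrix.of fun i j : Fin 3 => if i.val + j.val + 1 = 3 then (1 : L) else 0)).toLocal v) c = δ v) ∧
      ConjClasses.map (UnitaryGroup.archPart (↥(maximalRealSubfield L)) L (IsCMField.complexConj L) 3
        (Matrix.of fun i j : Fin 3 => if i.val + j.val + 1 = 3 then (1 : L) else 0)) c = b := by
  classical
  -- representatives: `γ_v` on the base classes, `out (δ v)` elsewhere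
  let γv : ∀ v : HeightOneSpectrum (𝓞 ↥(maximalRealSubfield L)),
      (UnitaryGroup.cmDatum L 3 (Matrix.of fun i j : Fin 3 => if i.val + j.val + 1 = 3 then (1 : L) else 0)).Local v := fun v =>
    (UnitaryGroup.cmDatum L 3 (Matrix.of fun i j : Fin 3 => if i.val + j.val + 1 = 3 then (1 : L) else 0)).toLocal v
      ((UnitaryGroup.cmDatum L 3 (Matrix.of fun i j : Fin 3 => if i.val + j.val + 1 = 3 then (1 : L) else 0)).toAdelic γ)
  let y : ∀ v : HeightOneSpectrum (𝓞 ↥(maximalRealSubfield L)),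
      (UnitaryGroup.cmDatum L 3 (Matrix.of fun i j : Fin 3 => if i.val + j.val + 1 = 3 then (1 : L) else 0)).Local v := fun v =>
    if δ v = ConjClasses.mk (γv v) then γv v else Quotient.out (δ v)
  have hy_mk : ∀ v, ConjClasses.mk (y v) = δ v := by
    intro v
    by_cases h : δ v = ConjClasses.mk (γv v)
    · rw [show y v = γv v from if_pos h, h]
    · rw [show y v = Quotient.out (δ v) from if_neg h]
      exact conjClasses_mk_out_eq _
  have hy_int : ∀ᶠ v in cofinite, y v ∈ UnitaryGroup.localIntegralLevel (IsCMField.complexConj L) 3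
      (Matrix.of fun i j : Fin 3 => if i.val + j.val + 1 = 3 then (1 : L) else 0) v := by
    filter_upwards [hev, eventually_toLocal_mem_cmLocalIntegralLevel
      ((UnitaryGroup.cmDatum L 3 (Matrix.of fun i j : Fin 3 => if i.val + j.val + 1 = 3 then (1 : L) else 0)).toAdelic γ)] with v hv hint
    have : y v = γv v := if_pos hv
    rw [this]
    exact hint
  obtain ⟨x, hxa, hxv⟩ := UnitaryGroup.exists_adelic_of_eventually_mem (↥(maximalRealSubfield L)) L (IsCMField.complexConj L) 3
    (Matrix.of fun i j : Fin 3 => if i.val + j.val + 1 = 3 then (1 : L) else 0) (Quotient.out b) y hy_int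
  -- read `x` and its components on the `cmDatum` carriers (definitionally the same objects)
  have hxv' : ∀ v, (UnitaryGroup.cmDatum L 3 (Matrix.of fun i j : Fin 3 => if i.val + j.val + 1 = 3 then (1 : L) else 0)).toLocal v x = y v :=
    fun v => hxv v
  -- `x` is a matching adèle over `γ₀`
  have hxcorr : ∀ v, Corresponds (UnitaryGroup.conjLocal L (IsCMField.complexConj L) v)
      ((UnitaryGroup.adelicForm L 3 H).map (UnitaryGroup.adeleToLocal L v))
      ((UnitaryGroup.adelicForm L 3 (Matrix.of fun i j : Fin 3 => if i.val + j.val + 1 = 3 then (1 : L) else 0)).map (UnitaryGroup.adeleToLocal L v))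
      ((UnitaryGroup.cmDatum L 3 H).toLocal v ((UnitaryGroup.cmDatum L 3 H).toAdelic γ₀))
      ((UnitaryGroup.cmDatum L 3 (Matrix.of fun i j : Fin 3 => if i.val + j.val + 1 = 3 then (1 : L) else 0)).toLocal v x) := by
    intro v
    rw [hxv' v]
    by_cases h : δ v = ConjClasses.mk (γv v)
    · have : y v = γv v := if_pos h
      rw [this]
      exact corresponds_toLocal_toAdelic hγ v
    · have : y v = Quotient.out (δ v) := if_neg h
      rw [this]
      exact hδ v
  let p : MatchingAdeleG L H γ₀ := ⟨x, hxcorr, by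
    show Corresponds _ _ _ (cmRationalToArch L 3 H γ₀)
      (UnitaryGroup.archPart (↥(maximalRealSubfield L)) L (IsCMField.complexConj L) 3
        (Matrix.of fun i j : Fin 3 => if i.val + j.val + 1 = 3 then (1 : L) else 0) x)
    rw [hxa]
    exact hb⟩
  refine ⟨ConjClasses.mk p.adele, ⟨p, rfl⟩, fun v => ?_, ?_⟩
  · rw [conjClasses_map_mk]
    exact (congrArg ConjClasses.mk (hxv' v)).trans (hy_mk v)
  · exact (congrArg ConjClasses.mk hxa).trans (conjClasses_mk_out_eq b)

end Dictionary

end Literature.NumberTheory.Rogawski1990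

end
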